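import Literature.NumberTheory.EllipticCurves.FormalGroupNegOmegaProofs
import HarnessLib

/-!
# The formal group of a Weierstrass curve under an admissible change of variables

Trunk T-NT-EC (Literature/NumberTheory/EllipticCurves). An admissible change of variables
`vc = (u, r, s, t)`, `x = u²x' + r`, `y = u³y' + u²s x' + t` (AEC III.1) carries the Weierstrass
curve `W` to `W' = vc • W` (Mathlib's `VariableChange`), points of `W` to points of `W'`, and
hence the formal group `Ŵ` (parameter `z = -x/y`, AEC IV.1) isomorphically onto `Ŵ'` (parameter
`z' = -x'/y'`). In the `(z, w)`-chart (`w = -1/y`, `x = z/w`) the isomorphism is the power series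

  `z' = θ(z) = u · (z - r·w(z)) / (1 + s·z + (t - s·r)·w(z)) = u z + ⋯ ∈ R⟦z⟧`

(`x' = u⁻²(x - r)`, `y' = u⁻³(y - s x + s r - t)`, so `z' = -x'/y' = -u(x - r)/(y - sx + sr - t)`;
insert `x = z/w`, `y = -1/w`). This file DEFINES `θ = formalVariableChange W vc` and proves, as
identities of formal power series over an ARBITRARY commutative ring, that `θ` transports every
object of the tree's formal-group layer (`FormalGroup.lean`, `PadicSigma.lean`,
`FormalInvariantDerivation.lean`):

* `formalW_variableChange_subst` — **`w'(θ(z)) = u³ w(z)/(1 + sz + (t - sr)w(z))`**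
  (`w' = -1/y'`): both sides solve the fixed-point equation of `W'` with parameter `θ`
  (AEC IV.1.1, uniqueness `fixedPoint_unique`); the verification is the Weierstrass equation of
  `W` in the `(z, w)`-chart;
* `formalXMulSq_variableChange_subst_mul_X_sq` — **`x'(θ(z)) = u⁻²(x(z) - r)`**, poles
  cleared: `X'(θ)·z² = u⁻²θ²·(X - r z²)` for `X = z²x = formalXMulSq`
  (and `formalXMulSq_variableChange_subst_mul_formalW`: `X'(θ)·w = (z - rw)³/den²`);
* `formalNeg_variableChange_subst` — **`i'(θ(z)) = θ(i(z))`**: the isomorphism commutes with the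
  formal inverse `[-1]` (the coordinate change carries `-P = (x, -y - a₁x - a₃)` to `-P'`,
  AEC III.2.3);
* `formalEta_mul_derivative_formalVariableChange` — **`η(z)·θ'(z) = u·η'(θ(z))`** for
  `η = 1 - f_w(z, w(z)) = (ω/dz)⁻¹` (`formalEta`), i.e. (`formalOmega_variableChange_subst_mul`,
  over `ℚ`-algebras) **`ω'(θ(z))·θ'(z) dz = u·ω(z) dz`: the invariant differential pulls back to
  `u·ω`** (AEC III.1, Table 3.1: `u⁻¹ω' = ω`);
* `formalInvariantDerivation_subst_formalVariableChange` — hence the chain rule for the invariant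
  derivations `D = d/ω`, `D' = d/ω'`: **`D(h ∘ θ) = u·(D'h) ∘ θ`** (`D' = u⁻¹D` on functions).

These are the ingredients of the transport of Mazur–Tate sigma pairs along `vc`
(`σ_W = u⁻¹·σ_{W'} ∘ θ`, `c_W = u²c_{W'} - r`; sequel `PadicSigmaVariableChangeProofs.lean`),
by which an existence theorem for the Mazur–Tate sigma function of a SHORT Weierstrass model
(Blakestad–Grant 2023, Thm. 1/Thm. 15: `y² = x³ + a₄x + a₆`) reaches the `p`-adic base change of a
globally minimal equation, the setting of the tree's named fact
`WeierstrassCurve.mazur_tate_sigma_existsUnique` (`PadicSigma.lean`).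

## Sources

* J. H. Silverman, *The Arithmetic of Elliptic Curves*, 2nd ed. (2009): III.1 (admissible changes
  of variables `x = u²x' + r`, `y = u³y' + u²sx' + t`, Table 3.1 incl. `u⁻¹ω' = ω`), III.2.3,
  IV.1 (pp. 115–118: `z = -x/y`, `w = -1/y`, Prop. 1.1 and Lemma 1.2, the expansions of `x(z)`,
  `ω(z)`, `i(z)`). [SilvermanAEC2009]
* B. Mazur, J. Tate, *The `p`-adic sigma function*, Duke Math. J. 62 (1991), §3 (dependence of
  `σ` on the pair `(E, ω)`); C. Blakestad, D. Grant, J. Number Theory 249 (2023), §2 (weights: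
  `(t, ω) ↦ (λ⁻¹t, λ⁻¹ω)` under `x ↦ λ²x`, `y ↦ λ³y`), Thm. 15. [BlakestadGrant2023]

## Design notes

Pure algebra over a commutative ring `R`: `vc.u` is a unit, nothing is inverted except unit power
series (`PowerSeries.invOfUnit`), divisions by `z` are `PowerSeries.X_pow_mul_cancel`. The
identities are closed by `linear_combination` from the fixed point `w = f(z, w)` (AEC IV.1.1(a)),
its derivative, `i·E = -z`, `w(i)·E = -w` (`E = 1 - a₁z - a₃w`) and `den · den⁻¹ = 1`, with
explicit cofactors. Two definitions (`formalVariableChangeDenom`, `formalVariableChange`), no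
named facts.
-/

noncomputable section

open PowerSeries Literature.NumberTheory.EllipticCurves

namespace WeierstrassCurve

variable {R : Type*} [CommRing R] (W : WeierstrassCurve R) (vc : VariableChange R)

/-! ### The isomorphism `θ` of formal groups induced by a change of variables -/

/-- The denominator `1 + s·z + (t - s·r)·w(z)` of `θ` (it is `w(z)·(y - s x + s r - t)·(-1)`,
`w = -1/y`, `x = z/w`): a unit of `R⟦z⟧`. [Silverman AEC III.1, IV.1] [folklore] -/
def formalVariableChangeDenom : R⟦X⟧ :=
  1 + C vc.s * X + C (vc.t - vc.s * vc.r) * W.formalW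

/-- **The isomorphism of formal groups `Ŵ ⥲ (vc • W)^` induced by the admissible change of
variables `vc = (u, r, s, t)`, `x = u²x' + r`, `y = u³y' + u²sx' + t`, as a power series in the
parameter `z = -x/y` of `W`:** the parameter `z' = -x'/y'` of `vc • W` at the image point is
`θ(z) = u·(z - r·w(z))/(1 + s·z + (t - s·r)·w(z)) = u·z + O(z²)`.
[Silverman AEC III.1 (changes of variables), IV.1 (`z = -x/y`, `w = -1/y`)] [folklore] -/
def formalVariableChange : R⟦X⟧ :=
  C (vc.u : R) * (X - C vc.r * W.formalW) * invOfUnit (W.formalVariableChangeDenom vc) 1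

/-- `den(0) = 1`. [folklore] -/
@[simp] theorem constantCoeff_formalVariableChangeDenom :
    constantCoeff (W.formalVariableChangeDenom vc) = 1 := by
  simp [formalVariableChangeDenom, W.constantCoeff_formalW]

/-- `den · den⁻¹ = 1`. [folklore] -/
theorem formalVariableChangeDenom_mul_invOfUnit :
    W.formalVariableChangeDenom vc * invOfUnit (W.formalVariableChangeDenom vc) 1 = 1 :=
  mul_invOfUnit _ 1 (by rw [constantCoeff_formalVariableChangeDenom, Units.val_one])

/-- `den` is a unit. [folklore] -/
theorem isUnit_formalVariableChangeDenom : IsUnit (W.formalVariableChangeDenom vc) :=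
  IsUnit.of_mul_eq_one _ (W.formalVariableChangeDenom_mul_invOfUnit vc)

/-- Unfolding `θ = u·(z - r w)·den⁻¹`. [folklore] -/
theorem formalVariableChange_def : W.formalVariableChange vc =
    C (vc.u : R) * (X - C vc.r * W.formalW) * invOfUnit (W.formalVariableChangeDenom vc) 1 := rfl

/-- `θ · den = u·(z - r·w)`. [folklore] -/
theorem formalVariableChange_mul_denom :
    W.formalVariableChange vc * W.formalVariableChangeDenom vc =
      C (vc.u : R) * (X - C vc.r * W.formalW) := by
  rw [formalVariableChange_def, mul_assoc, mul_comm (invOfUnit _ _),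
    formalVariableChangeDenom_mul_invOfUnit, mul_one]

/-- `θ(0) = 0`. [folklore] -/
@[simp] theorem constantCoeff_formalVariableChange :
    constantCoeff (W.formalVariableChange vc) = 0 := by
  simp [formalVariableChange, W.constantCoeff_formalW]

/-- `θ` is substitutable. [folklore] -/
theorem hasSubst_formalVariableChange : HasSubst (W.formalVariableChange vc) :=
  HasSubst.of_constantCoeff_zero' (W.constantCoeff_formalVariableChange vc)

/-- **`θ(z) = u·z + O(z²)`**: the linear coefficient of the isomorphism is the unit `u`
(`dz'/dz(0) = u`, matching `u⁻¹ω' = ω`). [Silverman AEC III.1, IV.1] [folklore] -/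
theorem coeff_one_formalVariableChange : coeff 1 (W.formalVariableChange vc) = vc.u := by
  have hw1 : coeff 1 W.formalW = 0 := W.coeff_formalW_of_lt_three (by norm_num)
  have hw0 : constantCoeff W.formalW = 0 := W.constantCoeff_formalW
  rw [formalVariableChange, PowerSeries.coeff_one_mul, PowerSeries.coeff_one_mul]
  simp [hw0, hw1, coeff_one_X, constantCoeff_invOfUnit]

/-! ### The coefficients of `vc • W`, multiplied by powers of `u` -/

section Coefficients

/-- `u · u⁻¹ = 1` in `R⟦z⟧`. [folklore] -/
theorem C_u_mul_C_u_inv : (C (vc.u : R) : R⟦X⟧) * C ((vc.u⁻¹ : Rˣ) : R) = 1 := by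
  rw [← map_mul, Units.mul_inv, map_one]

/-- `u · a₁' = a₁ + 2s`. [Silverman AEC III.1, Table 3.1] [folklore] -/
theorem C_u_mul_C_variableChange_a₁ :
    (C (vc.u : R) : R⟦X⟧) * C (vc • W).a₁ = C W.a₁ + 2 * C vc.s := by
  rw [variableChange_a₁, map_mul, ← mul_assoc, C_u_mul_C_u_inv, one_mul, map_add, map_mul,
    map_ofNat]

/-- `u² · a₂' = a₂ - s a₁ + 3r - s²`. [Silverman AEC III.1, Table 3.1] [folklore] -/
theorem C_u_sq_mul_C_variableChange_a₂ :
    (C (vc.u : R) : R⟦X⟧) ^ 2 * C (vc • W).a₂ =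
      C W.a₂ - C vc.s * C W.a₁ + 3 * C vc.r - C vc.s ^ 2 := by
  rw [variableChange_a₂, map_mul, ← mul_assoc, map_pow, ← mul_pow, C_u_mul_C_u_inv, one_pow,
    one_mul]
  simp only [map_add, map_sub, map_mul, map_pow, map_ofNat]

/-- `u³ · a₃' = a₃ + r a₁ + 2t`. [Silverman AEC III.1, Table 3.1] [folklore] -/
theorem C_u_pow_three_mul_C_variableChange_a₃ :
    (C (vc.u : R) : R⟦X⟧) ^ 3 * C (vc • W).a₃ = C W.a₃ + C vc.r * C W.a₁ + 2 * C vc.t := by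
  rw [variableChange_a₃, map_mul, ← mul_assoc, map_pow, ← mul_pow, C_u_mul_C_u_inv, one_pow,
    one_mul]
  simp only [map_add, map_mul, map_ofNat]

/-- `u⁴ · a₄' = a₄ - s a₃ + 2r a₂ - (t + r s) a₁ + 3r² - 2 s t`. [Silverman AEC III.1, Table 3.1]
[folklore] -/
theorem C_u_pow_four_mul_C_variableChange_a₄ :
    (C (vc.u : R) : R⟦X⟧) ^ 4 * C (vc • W).a₄ =
      C W.a₄ - C vc.s * C W.a₃ + 2 * C vc.r * C W.a₂ - (C vc.t + C vc.r * C vc.s) * C W.a₁ +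
        3 * C vc.r ^ 2 - 2 * C vc.s * C vc.t := by
  rw [variableChange_a₄, map_mul, ← mul_assoc, map_pow, ← mul_pow, C_u_mul_C_u_inv, one_pow,
    one_mul]
  simp only [map_add, map_sub, map_mul, map_pow, map_ofNat]

/-- `u⁶ · a₆' = a₆ + r a₄ + r² a₂ + r³ - t a₃ - t² - r t a₁`. [Silverman AEC III.1, Table 3.1]
[folklore] -/
theorem C_u_pow_six_mul_C_variableChange_a₆ :
    (C (vc.u : R) : R⟦X⟧) ^ 6 * C (vc • W).a₆ =
      C W.a₆ + C vc.r * C W.a₄ + C vc.r ^ 2 * C W.a₂ + C vc.r ^ 3 - C vc.t * C W.a₃ -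
        C vc.t ^ 2 - C vc.r * C vc.t * C W.a₁ := by
  rw [variableChange_a₆, map_mul, ← mul_assoc, map_pow, ← mul_pow, C_u_mul_C_u_inv, one_pow,
    one_mul]
  simp only [map_add, map_sub, map_mul, map_pow]

end Coefficients

/-! ### `w' ∘ θ`: the `w`-coordinate of the image point -/

/-- **`w'(θ(z)) = u³·w(z)/(1 + s z + (t - s r) w(z))`** — the `w`-coordinate `w' = -1/y'` of the
image point (`y' = u⁻³(y - sx + sr - t)`, `y = -1/w`, `x = z/w`). Proof: `w'(θ)` is the unique
solution without constant term of the fixed-point equation `ω = θ³ + a₁'θω + a₂'θ²ω + a₃'ω² +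
a₄'θω² + a₆'ω³` of `vc • W` with parameter `θ` (AEC IV.1.1), and `u³w/den` solves it: multiplied
by `den³`, this is `u³` times the Weierstrass equation `w = f(z, w)` of `W` in the `(z, w)`-chart.
[Silverman AEC IV.1.1, III.1] [cite: SilvermanAEC2009, IV.1.1] -/
theorem formalW_variableChange_subst :
    (vc • W).formalW.subst (W.formalVariableChange vc) =
      C (vc.u : R) ^ 3 * W.formalW * invOfUnit (W.formalVariableChangeDenom vc) 1 := by
  have hθs := W.hasSubst_formalVariableChange vc
  have hθ0 := W.constantCoeff_formalVariableChange vc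
  have hD := W.formalVariableChangeDenom_mul_invOfUnit vc
  have hw : X ^ 3 + C W.a₁ * X * W.formalW + C W.a₂ * X ^ 2 * W.formalW + C W.a₃ * W.formalW ^ 2 +
      C W.a₄ * X * W.formalW ^ 2 + C W.a₆ * W.formalW ^ 3 = W.formalW := W.formalWStep_formalW
  have ha1 := W.C_u_mul_C_variableChange_a₁ vc
  have ha2 := W.C_u_sq_mul_C_variableChange_a₂ vc
  have ha3 := W.C_u_pow_three_mul_C_variableChange_a₃ vc
  have ha4 := W.C_u_pow_four_mul_C_variableChange_a₄ vc
  have ha6 := W.C_u_pow_six_mul_C_variableChange_a₆ vc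
  have hden : W.formalVariableChangeDenom vc = 1 + C vc.s * X + C (vc.t - vc.s * vc.r) * W.formalW :=
    rfl
  refine (vc • W).fixedPoint_unique (g := W.formalVariableChange vc) hθ0 ?_ ?_
    ((vc • W).formalW_subst_eq_fixedPoint hθs) ?_
  · exact MvPowerSeries.constantCoeff_subst_eq_zero (PowerSeries.HasSubst.const hθs)
      (fun _ => hθ0) (vc • W).constantCoeff_formalW
  · show constantCoeff (C (vc.u : R) ^ 3 * W.formalW * invOfUnit (W.formalVariableChangeDenom vc) 1) = 0
    simp [W.constantCoeff_formalW]
  · show C (vc.u : R) ^ 3 * W.formalW * invOfUnit (W.formalVariableChangeDenom vc) 1 =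
      W.formalVariableChange vc ^ 3 +
      C (vc • W).a₁ * W.formalVariableChange vc *
        (C (vc.u : R) ^ 3 * W.formalW * invOfUnit (W.formalVariableChangeDenom vc) 1) +
      C (vc • W).a₂ * W.formalVariableChange vc ^ 2 *
        (C (vc.u : R) ^ 3 * W.formalW * invOfUnit (W.formalVariableChangeDenom vc) 1) +
      C (vc • W).a₃ * (C (vc.u : R) ^ 3 * W.formalW * invOfUnit (W.formalVariableChangeDenom vc) 1) ^ 2 +
      C (vc • W).a₄ * W.formalVariableChange vc *
        (C (vc.u : R) ^ 3 * W.formalW * invOfUnit (W.formalVariableChangeDenom vc) 1) ^ 2 +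
      C (vc • W).a₆ * (C (vc.u : R) ^ 3 * W.formalW * invOfUnit (W.formalVariableChangeDenom vc) 1) ^ 3
    refine ((W.isUnit_formalVariableChangeDenom vc).pow 3).mul_left_cancel ?_
    rw [formalVariableChange_def]
    rw [hden] at hD ⊢
    simp only [map_sub, map_mul] at hD ⊢
    -- abbreviations (for the certificate only): `P = den·den⁻¹`, `N = z - r w`
    linear_combination
      ((1 + C vc.s * X + (C vc.t - C vc.s * C vc.r) * W.formalW) ^ 2 * C (vc.u : R) ^ 3 * W.formalW -
        (C (vc.u : R) ^ 3 * (X - C vc.r * W.formalW) ^ 3 *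
            (1 + (1 + C vc.s * X + (C vc.t - C vc.s * C vc.r) * W.formalW) *
                invOfUnit (1 + C vc.s * X + (C vc.t - C vc.s * C vc.r) * W.formalW) 1 +
              ((1 + C vc.s * X + (C vc.t - C vc.s * C vc.r) * W.formalW) *
                invOfUnit (1 + C vc.s * X + (C vc.t - C vc.s * C vc.r) * W.formalW) 1) ^ 2) +
          C (vc • W).a₁ * C (vc.u : R) ^ 4 * (X - C vc.r * W.formalW) * W.formalW *
            (1 + C vc.s * X + (C vc.t - C vc.s * C vc.r) * W.formalW) *
            (1 + (1 + C vc.s * X + (C vc.t - C vc.s * C vc.r) * W.formalW) *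
                invOfUnit (1 + C vc.s * X + (C vc.t - C vc.s * C vc.r) * W.formalW) 1) +
          C (vc • W).a₂ * C (vc.u : R) ^ 5 * (X - C vc.r * W.formalW) ^ 2 * W.formalW *
            (1 + (1 + C vc.s * X + (C vc.t - C vc.s * C vc.r) * W.formalW) *
                invOfUnit (1 + C vc.s * X + (C vc.t - C vc.s * C vc.r) * W.formalW) 1 +
              ((1 + C vc.s * X + (C vc.t - C vc.s * C vc.r) * W.formalW) *
                invOfUnit (1 + C vc.s * X + (C vc.t - C vc.s * C vc.r) * W.formalW) 1) ^ 2) +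
          C (vc • W).a₃ * C (vc.u : R) ^ 6 * W.formalW ^ 2 *
            (1 + C vc.s * X + (C vc.t - C vc.s * C vc.r) * W.formalW) *
            (1 + (1 + C vc.s * X + (C vc.t - C vc.s * C vc.r) * W.formalW) *
                invOfUnit (1 + C vc.s * X + (C vc.t - C vc.s * C vc.r) * W.formalW) 1) +
          C (vc • W).a₄ * C (vc.u : R) ^ 7 * (X - C vc.r * W.formalW) * W.formalW ^ 2 *
            (1 + (1 + C vc.s * X + (C vc.t - C vc.s * C vc.r) * W.formalW) *
                invOfUnit (1 + C vc.s * X + (C vc.t - C vc.s * C vc.r) * W.formalW) 1 +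
              ((1 + C vc.s * X + (C vc.t - C vc.s * C vc.r) * W.formalW) *
                invOfUnit (1 + C vc.s * X + (C vc.t - C vc.s * C vc.r) * W.formalW) 1) ^ 2) +
          C (vc • W).a₆ * C (vc.u : R) ^ 9 * W.formalW ^ 3 *
            (1 + (1 + C vc.s * X + (C vc.t - C vc.s * C vc.r) * W.formalW) *
                invOfUnit (1 + C vc.s * X + (C vc.t - C vc.s * C vc.r) * W.formalW) 1 +
              ((1 + C vc.s * X + (C vc.t - C vc.s * C vc.r) * W.formalW) *
                invOfUnit (1 + C vc.s * X + (C vc.t - C vc.s * C vc.r) * W.formalW) 1) ^ 2))) * hD +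
      (-(C (vc.u : R) ^ 3 * (X - C vc.r * W.formalW) * W.formalW *
        (1 + C vc.s * X + (C vc.t - C vc.s * C vc.r) * W.formalW))) * ha1 +
      (-(C (vc.u : R) ^ 3 * (X - C vc.r * W.formalW) ^ 2 * W.formalW)) * ha2 +
      (-(C (vc.u : R) ^ 3 * W.formalW ^ 2 *
        (1 + C vc.s * X + (C vc.t - C vc.s * C vc.r) * W.formalW))) * ha3 +
      (-(C (vc.u : R) ^ 3 * (X - C vc.r * W.formalW) * W.formalW ^ 2)) * ha4 +
      (-(C (vc.u : R) ^ 3 * W.formalW ^ 3)) * ha6 +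
      (-(C (vc.u : R) ^ 3)) * hw


/-! ### `x' ∘ θ`: the `x`-coordinate of the image point -/

/-- `X'(θ(z))·w(z) = (z - r w(z))³/den²` (`X' = z'²x'`): from `X'·w' = z'³` (`x' = z'/w'`) at
`z' = θ`, and `w'(θ) = u³w/den`. [Silverman AEC IV.1, III.1] [folklore] -/
theorem formalXMulSq_variableChange_subst_mul_formalW :
    (vc • W).formalXMulSq.subst (W.formalVariableChange vc) * W.formalW =
      (X - C vc.r * W.formalW) ^ 3 * invOfUnit (W.formalVariableChangeDenom vc) 1 ^ 2 := by
  have hθs := W.hasSubst_formalVariableChange vc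
  have hD := W.formalVariableChangeDenom_mul_invOfUnit vc
  have hu := C_u_mul_C_u_inv vc
  have hθ := W.formalVariableChange_mul_denom vc
  have h1 : ((vc • W).formalXMulSq * (vc • W).formalW).subst (W.formalVariableChange vc) =
      ((X : R⟦X⟧) ^ 3).subst (W.formalVariableChange vc) := by
    rw [(vc • W).formalXMulSq_mul_formalW]
  rw [subst_mul hθs, subst_pow hθs, subst_X hθs, W.formalW_variableChange_subst vc] at h1
  set T := (vc • W).formalXMulSq.subst (W.formalVariableChange vc) with hT
  set θ := W.formalVariableChange vc with hθdef
  set Dinv := invOfUnit (W.formalVariableChangeDenom vc) 1 with hDinvdef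
  set den := W.formalVariableChangeDenom vc with hdendef
  set w := W.formalW with hwdef
  set u : R⟦X⟧ := C (vc.u : R) with hudef
  set ui : R⟦X⟧ := C ((vc.u⁻¹ : Rˣ) : R) with huidef
  set N : R⟦X⟧ := X - C vc.r * W.formalW with hNdef
  linear_combination (ui ^ 3 * den) * h1 +
    ((N ^ 3 * Dinv ^ 2 - T * w) * (1 + u * ui + (u * ui) ^ 2) * den * Dinv) * hu +
    (-(T * w) + N ^ 3 * Dinv ^ 2 -
      ui ^ 3 * den * θ * (θ ^ 2 + θ * u * N * Dinv + u ^ 2 * N ^ 2 * Dinv ^ 2)) * hD +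
    (ui ^ 3 * den * Dinv * (θ ^ 2 + θ * u * N * Dinv + u ^ 2 * N ^ 2 * Dinv ^ 2)) * hθ

/-- **`x'(θ(z)) = u⁻²·(x(z) - r)`** — the `x`-coordinate of the image point — with the poles
cleared: `X'(θ(z))·z² = u⁻²·θ(z)²·(X(z) - r z²)` for `X = z²x(z) = formalXMulSq`
(`x = X/z²`, `x' = X'/z'²`). [Silverman AEC III.1 (`x = u²x' + r`), IV.1]
[cite: SilvermanAEC2009, IV.1.1] -/
theorem formalXMulSq_variableChange_subst_mul_X_sq :
    (vc • W).formalXMulSq.subst (W.formalVariableChange vc) * X ^ 2 =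
      C ((vc.u⁻¹ : Rˣ) : R) ^ 2 * W.formalVariableChange vc ^ 2 *
        (W.formalXMulSq - C vc.r * X ^ 2) := by
  have hTw := W.formalXMulSq_variableChange_subst_mul_formalW vc
  have hXw := W.formalXMulSq_mul_formalW
  have hD := W.formalVariableChangeDenom_mul_invOfUnit vc
  have hu := C_u_mul_C_u_inv vc
  have hθ := W.formalVariableChange_mul_denom vc
  have hwB := W.formalW_eq_X_pow_mul_formalWDivCube
  have hB : IsUnit W.formalWDivCube := by
    rw [PowerSeries.isUnit_iff_constantCoeff, W.constantCoeff_formalWDivCube]; exact isUnit_one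
  set T := (vc • W).formalXMulSq.subst (W.formalVariableChange vc) with hT
  set θ := W.formalVariableChange vc with hθdef
  set Dinv := invOfUnit (W.formalVariableChangeDenom vc) 1 with hDinvdef
  set den := W.formalVariableChangeDenom vc with hdendef
  set u : R⟦X⟧ := C (vc.u : R) with hudef
  set ui : R⟦X⟧ := C ((vc.u⁻¹ : Rˣ) : R) with huidef
  -- the identity multiplied by `w = z³·B`
  have key : W.formalW * (T * X ^ 2) =
      W.formalW * (ui ^ 2 * θ ^ 2 * (W.formalXMulSq - C vc.r * X ^ 2)) := by
    linear_combination (X ^ 2) * hTw + (-(ui ^ 2 * θ ^ 2)) * hXw +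
      (-(X ^ 2 * (X - C vc.r * W.formalW) ^ 2 * Dinv *
        ((X - C vc.r * W.formalW) * Dinv + ui * θ))) * hu +
      (-(X ^ 2 * (X - C vc.r * W.formalW) * ((X - C vc.r * W.formalW) * Dinv + ui * θ) *
        ui * Dinv)) * hθ +
      (X ^ 2 * (X - C vc.r * W.formalW) * ((X - C vc.r * W.formalW) * Dinv + ui * θ) *
        ui * θ) * hD
  rw [hwB, mul_assoc, mul_assoc] at key
  exact hB.mul_left_cancel (PowerSeries.X_pow_mul_cancel key)

/-! ### `θ` commutes with the formal inverse -/

/-- **`i'(θ(z)) = θ(i(z))`: the isomorphism `θ` commutes with `[-1]`** (the coordinate change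
carries `-P = (x, -y - a₁x - a₃)` to `-P'`, AEC III.2.3). With `E = 1 - a₁z - a₃w`,
`M = 1 - (a₁ + s)z - (a₃ + t - sr)w`: both sides times the unit `M` equal `-u(z - r w)`
(`i·E = -z`, `w(i)·E = -w`, `E'(θ)·den = M`). [Silverman AEC III.2.3, IV.1 (p. 118, `i(z)`)]
[cite: SilvermanAEC2009, IV.1.1] -/
theorem formalNeg_variableChange_subst :
    (vc • W).formalNeg.subst (W.formalVariableChange vc) =
      (W.formalVariableChange vc).subst W.formalNeg := by
  have hθs := W.hasSubst_formalVariableChange vc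
  have his := W.hasSubst_formalNeg
  have hD := W.formalVariableChangeDenom_mul_invOfUnit vc
  have hθ := W.formalVariableChange_mul_denom vc
  have ha1 := W.C_u_mul_C_variableChange_a₁ vc
  have ha3 := W.C_u_pow_three_mul_C_variableChange_a₃ vc
  have hiE := W.formalNeg_mul_formalNegDenom
  have hwiE := W.formalW_subst_formalNeg_mul_formalNegDenom
  have hCi : ∀ a : R, (C a).subst W.formalNeg = C a := fun a => PowerSeries.subst_C a
  have hCθ : ∀ a : R, (C a).subst (W.formalVariableChange vc) = C a := fun a => PowerSeries.subst_C a
  have hden : W.formalVariableChangeDenom vc = 1 + C vc.s * X + C (vc.t - vc.s * vc.r) * W.formalW :=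
    rfl
  have hM : IsUnit (1 - (C W.a₁ + C vc.s) * X - (C W.a₃ + C vc.t - C vc.s * C vc.r) * W.formalW) := by
    rw [PowerSeries.isUnit_iff_constantCoeff]
    simp [W.constantCoeff_formalW]
  -- (i) `θ(i) · M = -u (z - r w)`
  have hDi : (W.formalVariableChangeDenom vc).subst W.formalNeg *
      (invOfUnit (W.formalVariableChangeDenom vc) 1).subst W.formalNeg = 1 := by
    rw [← subst_mul his, hD, ← coe_substAlgHom his, map_one]
  have hdeni : (W.formalVariableChangeDenom vc).subst W.formalNeg =
      1 + C vc.s * W.formalNeg + (C vc.t - C vc.s * C vc.r) * W.formalW.subst W.formalNeg := by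
    rw [hden]
    simp only [← coe_substAlgHom his, map_add, map_sub, map_one, map_mul, substAlgHom_X]
    simp only [coe_substAlgHom his, hCi]
  have hθi : (W.formalVariableChange vc).subst W.formalNeg =
      C (vc.u : R) * (W.formalNeg - C vc.r * W.formalW.subst W.formalNeg) *
        (invOfUnit (W.formalVariableChangeDenom vc) 1).subst W.formalNeg := by
    rw [formalVariableChange_def]
    simp only [← coe_substAlgHom his, map_sub, map_mul, substAlgHom_X]
    simp only [coe_substAlgHom his, hCi]
  rw [hdeni] at hDi
  have hR : (W.formalVariableChange vc).subst W.formalNeg *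
      (1 - (C W.a₁ + C vc.s) * X - (C W.a₃ + C vc.t - C vc.s * C vc.r) * W.formalW) =
      -(C (vc.u : R) * (X - C vc.r * W.formalW)) := by
    rw [hθi]
    set Dvi := (invOfUnit (W.formalVariableChangeDenom vc) 1).subst W.formalNeg with hDvi
    set i := W.formalNeg with hidef
    set wi := W.formalW.subst W.formalNeg with hwidef
    set w := W.formalW with hwdef
    set u : R⟦X⟧ := C (vc.u : R) with hudef
    linear_combination (u * (i - C vc.r * wi) * (1 - C W.a₁ * X - C W.a₃ * w)) * hDi +
      (u - u * (i - C vc.r * wi) * Dvi * C vc.s) * hiE +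
      (-(u * C vc.r) - u * (i - C vc.r * wi) * Dvi * (C vc.t - C vc.s * C vc.r)) * hwiE
  -- (ii) `i'(θ) · M = -u (z - r w)`
  have hE' := (vc • W).formalNegDenom_mul_invOfUnit
  have hE'θ : (1 - C (vc • W).a₁ * W.formalVariableChange vc -
      C (vc • W).a₃ * (C (vc.u : R) ^ 3 * W.formalW * invOfUnit (W.formalVariableChangeDenom vc) 1)) *
      (invOfUnit (1 - C (vc • W).a₁ * X - C (vc • W).a₃ * (vc • W).formalW) 1).subst
        (W.formalVariableChange vc) = 1 := by
    have e := congrArg (PowerSeries.subst (W.formalVariableChange vc)) hE'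
    rw [subst_mul hθs] at e
    simp only [← coe_substAlgHom hθs, map_sub, map_one, map_mul, substAlgHom_X] at e
    simp only [coe_substAlgHom hθs, hCθ, W.formalW_variableChange_subst vc] at e
    exact e
  have hi'θ : (vc • W).formalNeg.subst (W.formalVariableChange vc) =
      -(W.formalVariableChange vc *
        (invOfUnit (1 - C (vc • W).a₁ * X - C (vc • W).a₃ * (vc • W).formalW) 1).subst
          (W.formalVariableChange vc)) := by
    rw [(vc • W).formalNeg_eq]
    simp only [← coe_substAlgHom hθs, map_neg, map_mul, substAlgHom_X]
  have hL : (vc • W).formalNeg.subst (W.formalVariableChange vc) *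
      (1 - (C W.a₁ + C vc.s) * X - (C W.a₃ + C vc.t - C vc.s * C vc.r) * W.formalW) =
      -(C (vc.u : R) * (X - C vc.r * W.formalW)) := by
    rw [hi'θ]
    set Eiθ := (invOfUnit (1 - C (vc • W).a₁ * X - C (vc • W).a₃ * (vc • W).formalW) 1).subst
      (W.formalVariableChange vc) with hEiθ
    set θ := W.formalVariableChange vc with hθdef
    set Dinv := invOfUnit (W.formalVariableChangeDenom vc) 1 with hDinvdef
    rw [hden] at hθ hD
    simp only [map_sub, map_mul] at hθ hD
    set w := W.formalW with hwdef
    set u : R⟦X⟧ := C (vc.u : R) with hudef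
    linear_combination (-(θ * (1 + C vc.s * X + (C vc.t - C vc.s * C vc.r) * w))) * hE'θ +
      (-1 - θ * Eiθ * C (vc • W).a₁) * hθ + (-(θ * Eiθ * (X - C vc.r * w))) * ha1 +
      (-(θ * Eiθ * w)) * ha3 + (-(θ * Eiθ * C (vc • W).a₃ * u ^ 3 * w)) * hD
  exact hM.mul_right_cancel (hL.trans hR.symm)

/-! ### `θ` and the invariant differential: `η·θ' = u·η'(θ)` -/

/-- **`η(z)·θ'(z) = u·η'(θ(z))`** for `η = 1 - f_w(z, w(z)) = (ω/dz)⁻¹` (`formalEta`) of `W` and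
`η'` that of `vc • W`: the invariant differential pulls back along the isomorphism `θ` to `u·ω`
(`u⁻¹ω' = ω`, AEC III.1 Table 3.1). A polynomial identity in `z, w` modulo the fixed point
`w = f(z, w)` and its derivative `η·w' = f_z`. [Silverman AEC III.1 (Table 3.1), IV.1]
[cite: SilvermanAEC2009, IV.1.1] -/
theorem formalEta_mul_derivative_formalVariableChange :
    W.formalEta * d⁄dX R (W.formalVariableChange vc) =
      C (vc.u : R) * (vc • W).formalEta.subst (W.formalVariableChange vc) := by
  have hθs := W.hasSubst_formalVariableChange vc
  have hD := W.formalVariableChangeDenom_mul_invOfUnit vc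
  have ha1 := W.C_u_mul_C_variableChange_a₁ vc
  have ha2 := W.C_u_sq_mul_C_variableChange_a₂ vc
  have ha3 := W.C_u_pow_three_mul_C_variableChange_a₃ vc
  have ha4 := W.C_u_pow_four_mul_C_variableChange_a₄ vc
  have ha6 := W.C_u_pow_six_mul_C_variableChange_a₆ vc
  have hη := W.formalEta_def
  have hηw := W.formalEta_mul_derivative_formalW
  have hw : X ^ 3 + C W.a₁ * X * W.formalW + C W.a₂ * X ^ 2 * W.formalW + C W.a₃ * W.formalW ^ 2 +
      C W.a₄ * X * W.formalW ^ 2 + C W.a₆ * W.formalW ^ 3 = W.formalW := W.formalWStep_formalW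
  have hCθ : ∀ a : R, (C a).subst (W.formalVariableChange vc) = C a := fun a => PowerSeries.subst_C a
  have hden : W.formalVariableChangeDenom vc = 1 + C vc.s * X + C (vc.t - vc.s * vc.r) * W.formalW :=
    rfl
  -- `η'(θ)` expanded, with `w'(θ) = u³ w / den`
  have hη'θ : (vc • W).formalEta.subst (W.formalVariableChange vc) =
      1 - (C (vc • W).a₁ * W.formalVariableChange vc + C (vc • W).a₂ * W.formalVariableChange vc ^ 2 +
        2 * C (vc • W).a₃ * (C (vc.u : R) ^ 3 * W.formalW * invOfUnit (W.formalVariableChangeDenom vc) 1) +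
        2 * C (vc • W).a₄ * W.formalVariableChange vc *
          (C (vc.u : R) ^ 3 * W.formalW * invOfUnit (W.formalVariableChangeDenom vc) 1) +
        3 * C (vc • W).a₆ *
          (C (vc.u : R) ^ 3 * W.formalW * invOfUnit (W.formalVariableChangeDenom vc) 1) ^ 2) := by
    rw [(vc • W).formalEta_def]
    simp only [← coe_substAlgHom hθs, map_add, map_sub, map_one, map_mul, map_pow, map_ofNat,
      substAlgHom_X]
    simp only [coe_substAlgHom hθs, hCθ, W.formalW_variableChange_subst vc]
  -- `θ'`
  have hθ' : d⁄dX R (W.formalVariableChange vc) =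
      C (vc.u : R) * ((1 - C vc.r * d⁄dX R W.formalW) * invOfUnit (W.formalVariableChangeDenom vc) 1 +
        (X - C vc.r * W.formalW) * d⁄dX R (invOfUnit (W.formalVariableChangeDenom vc) 1)) := by
    rw [formalVariableChange_def]
    simp only [Derivation.leibniz, map_sub, derivative_C, derivative_X, smul_eq_mul]
    ring
  -- `(den · den⁻¹)' = 0`
  have hD' : W.formalVariableChangeDenom vc * d⁄dX R (invOfUnit (W.formalVariableChangeDenom vc) 1) +
      invOfUnit (W.formalVariableChangeDenom vc) 1 *
        (C vc.s + C (vc.t - vc.s * vc.r) * d⁄dX R W.formalW) = 0 := by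
    have e := congrArg (d⁄dX R) hD
    have hden' : d⁄dX R (W.formalVariableChangeDenom vc) = C vc.s + C (vc.t - vc.s * vc.r) * d⁄dX R W.formalW := by
      rw [hden]
      simp only [Derivation.leibniz, map_add, derivative_C, derivative_X, smul_eq_mul,
        Derivation.map_one_eq_zero]
      ring
    rw [Derivation.leibniz, smul_eq_mul, smul_eq_mul, Derivation.map_one_eq_zero, hden'] at e
    exact e
  rw [hθ', hη'θ]
  refine ((W.isUnit_formalVariableChangeDenom vc).pow 2).mul_left_cancel ?_
  rw [formalVariableChange_def]
  rw [hden] at hD hD' ⊢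
  simp only [map_sub, map_mul] at hD hD' ⊢
  set Dinv := invOfUnit (1 + C vc.s * X + (C vc.t - C vc.s * C vc.r) * W.formalW) 1 with hDinvdef
  set dDinv := d⁄dX R Dinv with hdDinv
  set w := W.formalW with hwdef
  set dw := d⁄dX R W.formalW with hdwdef
  set η := W.formalEta with hηdef
  set u : R⟦X⟧ := C (vc.u : R) with hudef
  set N : R⟦X⟧ := X - C vc.r * w with hNdef
  set den : R⟦X⟧ := 1 + C vc.s * X + (C vc.t - C vc.s * C vc.r) * w with hdendef
  linear_combination (-3 * u * C vc.t) * hw + (u * (den - N * C vc.s)) * hη +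
    (u * (-(C vc.r * den) - N * (C vc.t - C vc.s * C vc.r))) * hηw +
    (η * u * ((1 - C vc.r * dw) * den - N * (C vc.s + (C vc.t - C vc.s * C vc.r) * dw)) +
      u * (C (vc • W).a₁ * u * N * den + C (vc • W).a₂ * u ^ 2 * N ^ 2 * (den * Dinv + 1) +
        2 * C (vc • W).a₃ * u ^ 3 * w * den + 2 * C (vc • W).a₄ * u ^ 4 * N * w * (den * Dinv + 1) +
        3 * C (vc • W).a₆ * u ^ 6 * w ^ 2 * (den * Dinv + 1))) * hD +
    (η * u * N * den) * hD' +
    (u * N * den) * ha1 + (u * N ^ 2) * ha2 + (2 * u * w * den) * ha3 + (2 * u * N * w) * ha4 +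
    (3 * u * w ^ 2) * ha6

/-- **The chain rule for the invariant derivations: `D(h ∘ θ) = u·(D'h) ∘ θ`** for every
`h ∈ R⟦z'⟧`, where `D = η·d/dz = d/ω` is the invariant derivation of `W` and `D' = d/ω'` that of
`vc • W` (`formalInvariantDerivation`); equivalently `D' = u⁻¹·D` on functions of the formal
group, as `ω' = u·ω`. [Silverman AEC III.1 (Table 3.1, `u⁻¹ω' = ω`); Blakestad–Grant 2023, §2
(weights of `t`, `ω`, `D`)] [cite: SilvermanAEC2009, IV.1.1] -/
theorem formalInvariantDerivation_subst_formalVariableChange (h : R⟦X⟧) :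
    W.formalInvariantDerivation (h.subst (W.formalVariableChange vc)) =
      C (vc.u : R) * ((vc • W).formalInvariantDerivation h).subst (W.formalVariableChange vc) := by
  have hθs := W.hasSubst_formalVariableChange vc
  have key := W.formalEta_mul_derivative_formalVariableChange vc
  rw [formalInvariantDerivation_apply, formalInvariantDerivation_apply,
    PowerSeries.derivative_subst R hθs, subst_mul hθs]
  linear_combination ((d⁄dX R h).subst (W.formalVariableChange vc)) * key

/-- Iterating: `D(D(h ∘ θ)) = u²·(D'(D'h)) ∘ θ`. [folklore] -/
theorem formalInvariantDerivation_formalInvariantDerivation_subst_formalVariableChange (h : R⟦X⟧) :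
    W.formalInvariantDerivation (W.formalInvariantDerivation (h.subst (W.formalVariableChange vc))) =
      C (vc.u : R) ^ 2 *
        ((vc • W).formalInvariantDerivation ((vc • W).formalInvariantDerivation h)).subst
          (W.formalVariableChange vc) := by
  rw [W.formalInvariantDerivation_subst_formalVariableChange vc h, Derivation.leibniz,
    formalInvariantDerivation_C, smul_zero, add_zero, smul_eq_mul,
    W.formalInvariantDerivation_subst_formalVariableChange vc]
  ring

section RatAlgebra

variable {A : Type*} [CommRing A] [Algebra ℚ A] (V : WeierstrassCurve A) (vc' : VariableChange A)

/-- **`ω'(θ(z))·θ'(z) = u·ω(z)`: the pull-back of the invariant differential `ω' = dx'/(2y' +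
a₁'x' + a₃')` of `vc • W` along the isomorphism `θ` is `u` times that of `W`** (AEC III.1,
Table 3.1: `u⁻¹ω' = ω`), for the tree's `formalOmega` over a `ℚ`-algebra.
[Silverman AEC III.1 (Table 3.1), IV.1] [cite: SilvermanAEC2009, IV.1.1] -/
theorem formalOmega_variableChange_subst_mul_derivative :
    (vc' • V).formalOmega.subst (V.formalVariableChange vc') * d⁄dX A (V.formalVariableChange vc') =
      C (vc'.u : A) * V.formalOmega := by
  have hθs := V.hasSubst_formalVariableChange vc'
  have h := V.formalEta_mul_derivative_formalVariableChange vc'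
  have hωη := V.formalOmega_mul_formalEta
  have hωη' : (vc' • V).formalOmega.subst (V.formalVariableChange vc') *
      (vc' • V).formalEta.subst (V.formalVariableChange vc') = 1 := by
    rw [← subst_mul hθs, (vc' • V).formalOmega_mul_formalEta, ← coe_substAlgHom hθs, map_one]
  set ω := V.formalOmega
  set η := V.formalEta
  set ωθ := (vc' • V).formalOmega.subst (V.formalVariableChange vc')
  set ηθ := (vc' • V).formalEta.subst (V.formalVariableChange vc')
  set dθ := d⁄dX A (V.formalVariableChange vc')
  linear_combination (ω * ωθ) * h - (ωθ * dθ) * hωη + (C (vc'.u : A) * ω) * hωη'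

end RatAlgebra

end WeierstrassCurve
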